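import Mathlib
import Summits.CriticalPhenomena.CardyFormulaZ2.Theorems.CardyMagicRigidityDefs
import Summits.CriticalPhenomena.CardyFormulaZ2.Theorems.CardyMagicRigidityPositiveConeDefs
import Summits.CriticalPhenomena.CardyFormulaZ2.Theorems.CardyMagicRigidityNestingRigidityFusionBaseCases
import Summits.CriticalPhenomena.CardyFormulaZ2.Theorems.CardyMagicRigidityNestingRigidityLatticeRegularityZ2Boundary
import Literature.Probability.RandomPlanarGeometry.LoopWinding
import Literature.Probability.Percolation.FKLoopNestingIntegrable
import Literature.Probability.RandomPlanarGeometry.LocFinLoopConfig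
import HarnessLib

/-!
# Stub `stub_precompactness`, regular limits: `degreeOne` and `laminar` pass to `d_CN`-limits of configurations

Crux `Summit.CriticalPhenomena.CardyFormulaZ2.Theses.CardyMagicRigidity.NestingRigidity`
(stmt-CriticalPhenomena-4835), line `positive-cone-weight-doubling`, registered stub `stub_precompactness :
PrecompactRegular zEns ∧ PrecompactRegular tEns`.  Its second half (T2 of the stub map: every subsequential
`d_CN`-limit law of a lattice ensemble has an a.s.-`Regular` presentation) asks the five fields of `Regular` of a
LIMIT configuration.  Two of them are SOFT — they pass to limits in DKKMO's printed relation `d_CN ≤ η`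
(`LoopConfig.IsClose η`) from configurations having them, with no percolation estimate — and this file proves
exactly that, at the configuration level, for an arbitrary typed configuration `x : LoopConfig ℂ` that is
approximable at every scale `η > 0` by configurations `c` with `LoopConfig.IsClose η c x`:

* `Precompact.degreeOne_of_forall_isClose` — covering degree one (`W(u, z) ∈ {0, ±1}` for every loop `u` and point
  `z`) passes to `x`: off the trace of `u` the winding number of an `η`-close partner `u'` of `u` is `± W(u, z)` as
  soon as `η < dist(z, trace u)` (`UnbasedLoop.wind_eq_or_eq_neg_of_udist_lt`), and on the trace `W = 0` by
  convention;
* `laminar_of_forall_isClose` (registered anchor) — LAMINARITY (the winding interiors `{W(u,·) ≠ 0}`,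
  `{W(v,·) ≠ 0}` of any two loops are nested or disjoint) passes to `x`.  If the interiors `A`, `B` of `u, v ∈ x`
  were neither nested nor disjoint, pick `z₁ ∈ A \ B`, `z₂ ∈ B \ A`, `z₃ ∈ A ∩ B`; partners `u'`, `v'` at a scale
  `η` below all the relevant distances have intersecting interiors (at `z₃`), so by laminarity of the approximant
  `{W(u',·) ≠ 0} ⊆ {W(v',·) ≠ 0}` say; then at `z₁` either `z₁` is off the trace of `v` and `W(v', z₁) = ±W(v, z₁)
  = 0 ≠ ±W(u, z₁) = W(u', z₁)`, or `z₁` lies ON the trace of `v`, and then some point `y` of the trace of `v'` is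
  within `η` of `z₁`, where `W(u', y) = ±W(u, y) = ±W(u, z₁) ≠ 0` (local constancy of `W(u, ·)` off the trace) but
  `W(v', y) = 0` — the one-sided obstruction `Precompact.exists_threshold_not_subset`;
* `Precompact.degreeOne_laminar_of_forall_isClose_latticeEnsembles` — packaged with the landed lattice regularity
  (`regular_latticeEnsembles`, …LatticeRegularityZ2Boundary p105307 / …LatticeRegularityT): a configuration which
  is, at every scale, `d_CN ≤ η`-close to some positive-mesh configuration of `zEns` or `tEns` has `degreeOne` and
  `laminar` loops.  This is the configuration-level input of the a.s. statement "every `d_CN`-limit presentation `X`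
  of a lattice ensemble has `degreeOne`/`laminar` samples", whose remaining (measure-theoretic) step is: a.e. `s`,
  `X s` is approximable by lattice samples (disintegration of the couplings + Borel–Cantelli; needs measurable
  exceptional events).

The three other fields (`locallyFinite`, `boundary`, `separating`) do NOT pass to `d_CN`-limits of configurations
(counter-examples: accumulating circles; a circle plus a retraced arc; two concentric circles merging) and need
uniform lattice estimates; see the stub map `work/stubs/Precompactness-map.md` of seat c4-0.
-/

noncomputable section

open MeasureTheory Set Filter Metric
open scoped Real Topology BigOperators ENNReal

namespace Summit.CriticalPhenomena.CardyFormulaZ2.Cruxes.NestingRigidity.PositiveConeWeightDoubling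

open Literature.Probability.RandomPlanarGeometry Literature.Probability.Percolation
  Literature.Probability.LatticeModels
open Summit.CriticalPhenomena.CardyFormulaZ2.Theses.CardyMagicRigidity
open Summit.CriticalPhenomena.CardyFormulaZ2.Cruxes.NestingRigidity.RingCloudTomography

namespace Precompact

/-! ### Winding numbers off the trace: partners (local constancy is the tree's `UnbasedLoop.wind_eq_wind_of_dist_lt`) -/

/-- A point where a loop winds is at positive distance from the trace (`W = 0` on the trace, which is compact
and non-empty). -/
theorem infDist_range_pos_of_wind_ne_zero (u : UnbasedLoop ℂ) {z : ℂ} (hz : u.wind z ≠ 0) :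
    0 < infDist z u.range :=
  (u.isCompact_range.isClosed.notMem_iff_infDist_pos u.range_nonempty).1
    fun h ↦ hz (unbasedLoop_wind_of_mem_range u h)

/-- Winding numbers of an `η`-close partner off the trace, `η < dist(z, trace u)`: `W(u', z) = ±W(u, z)`; in
particular `W(u', z) ≠ 0 ↔ W(u, z) ≠ 0`. -/
theorem wind_ne_zero_iff_of_udist_le {u u' : UnbasedLoop ℂ} {z : ℂ} {η : ℝ} (hη : η < infDist z u.range)
    (hd : u.udist u' ≤ η) : u'.wind z ≠ 0 ↔ u.wind z ≠ 0 := by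
  rcases UnbasedLoop.wind_eq_or_eq_neg_of_udist_lt (hd.trans_lt hη) with h | h <;> simp [h]

/-- Every loop lies in some window `B(0, R)`, `R > 0`. -/
theorem exists_range_subset_ball (u : UnbasedLoop ℂ) : ∃ R : ℝ, 0 < R ∧ u.range ⊆ ball (0 : ℂ) R := by
  obtain ⟨R, hR⟩ := u.isCompact_range.isBounded.subset_ball (0 : ℂ)
  exact ⟨max R 1, by positivity, hR.trans (ball_subset_ball (le_max_left _ _))⟩

/-- Window arithmetic: a trace inside `B(0, R)` lies in the soft window `B(0, 1/η)` of `d_CN ≤ η` as soon as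
`0 < η ≤ 1/R`. -/
theorem range_subset_window {u : UnbasedLoop ℂ} {R η : ℝ} (hR : 0 < R) (hη : 0 < η) (hηR : η ≤ 1 / R)
    (h : u.range ⊆ ball (0 : ℂ) R) : u.range ⊆ ball (0 : ℂ) (1 / η) :=
  h.trans (ball_subset_ball ((le_one_div hη hR).1 hηR))

/-- Every loop of a configuration is of some type. -/
theorem exists_mem_F_of_mem_loops {c : LoopConfig ℂ} {u : UnbasedLoop ℂ} (hu : u ∈ c.loops) :
    ∃ i : Fin 2, u ∈ c.F i := by
  rcases hu with h | h
  exacts [⟨0, h⟩, ⟨1, h⟩]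

/-! ### Covering degree one passes to `d_CN`-limits -/

/-- **Covering degree one passes to `d_CN`-limits of configurations.**  If `x` is, at every scale `η > 0`,
`d_CN ≤ η`-close (printed relation `LoopConfig.IsClose η c x`) to a configuration `c` all of whose loops have
winding numbers in `{0, ±1}` everywhere, then so do all loops of `x`. -/
theorem degreeOne_of_forall_isClose {x : LoopConfig ℂ}
    (h : ∀ η : ℝ, 0 < η → ∃ c : LoopConfig ℂ,
      (∀ u ∈ c.loops, ∀ z : ℂ, u.wind z = 0 ∨ u.wind z = 1 ∨ u.wind z = -1) ∧ LoopConfig.IsClose η c x) :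
    ∀ u ∈ x.loops, ∀ z : ℂ, u.wind z = 0 ∨ u.wind z = 1 ∨ u.wind z = -1 := by
  intro u hu z
  by_cases hz : u.wind z = 0
  · exact Or.inl hz
  obtain ⟨i, hui⟩ := exists_mem_F_of_mem_loops hu
  have hρ : 0 < infDist z u.range := infDist_range_pos_of_wind_ne_zero u hz
  obtain ⟨R, hR, hsub⟩ := exists_range_subset_ball u
  set η : ℝ := min (infDist z u.range / 2) (1 / R) with hηdef
  have hη0 : 0 < η := by positivity
  obtain ⟨c, hc, hclose⟩ := h η hη0
  obtain ⟨u', hu', hd⟩ := (hclose i).2 u hui (range_subset_window hR hη0 (min_le_right _ _) hsub)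
  have hlt : η < infDist z u.range := by
    have := min_le_left (infDist z u.range / 2) (1 / R)
    rw [← hηdef] at this
    linarith
  have h' := hc u' (c.subset_loops i hu') z
  rcases UnbasedLoop.wind_eq_or_eq_neg_of_udist_lt (hd.trans_lt hlt) with h₁ | h₁ <;> rw [h₁] at h' <;> omega

/-! ### Laminarity passes to `d_CN`-limits -/

/-- **The one-sided obstruction.**  If `W(u, z) ≠ 0` and `W(v, z) = 0`, there is a threshold `τ > 0` such that no
`η`-close partners `u'`, `v'` of `u`, `v` with `η < τ` can have `{W(u',·) ≠ 0} ⊆ {W(v',·) ≠ 0}`.  Off the trace of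
`v` (`τ = min (dist(z, trace u)) (dist(z, trace v))`): `W(u', z) = ±W(u, z) ≠ 0` but `W(v', z) = ±W(v, z) = 0`.
On the trace of `v` (`τ = dist(z, trace u)/2`): some `y` on the trace of `v'` has `dist z y ≤ η`, and there
`W(u', y) = ±W(u, y) = ±W(u, z) ≠ 0` (local constancy) while `W(v', y) = 0`. -/
theorem exists_threshold_not_subset {u v : UnbasedLoop ℂ} {z : ℂ} (hu : u.wind z ≠ 0) (hv : v.wind z = 0) :
    ∃ τ : ℝ, 0 < τ ∧ ∀ (η : ℝ) (u' v' : UnbasedLoop ℂ), η < τ → u.udist u' ≤ η → v.udist v' ≤ η →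
      ¬ ({w | u'.wind w ≠ 0} ⊆ {w | v'.wind w ≠ 0}) := by
  have hρ : 0 < infDist z u.range := infDist_range_pos_of_wind_ne_zero u hu
  by_cases hzv : z ∈ v.range
  · refine ⟨infDist z u.range / 2, by positivity, fun η u' v' hη hdu hdv hsub ↦ ?_⟩
    obtain ⟨y, hy, hzy⟩ := UnbasedLoop.exists_mem_range_dist_le v v' hzv
    have hzy' : dist y z < infDist z u.range := by rw [dist_comm]; linarith
    -- `W(u, y) = W(u, z) ≠ 0`
    have huy : u.wind y ≠ 0 := by rwa [UnbasedLoop.wind_eq_wind_of_dist_lt u hzy']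
    -- `dist(y, trace u) > η`
    have hyu : η < infDist y u.range := by
      have := Metric.infDist_le_infDist_add_dist (s := u.range) (x := z) (y := y)
      linarith
    have hu'y : u'.wind y ≠ 0 := (wind_ne_zero_iff_of_udist_le hyu hdu).2 huy
    exact (hsub hu'y) (unbasedLoop_wind_of_mem_range v' hy)
  · have hσ : 0 < infDist z v.range :=
      (v.isCompact_range.isClosed.notMem_iff_infDist_pos v.range_nonempty).1 hzv
    refine ⟨min (infDist z u.range) (infDist z v.range), lt_min hρ hσ, fun η u' v' hη hdu hdv hsub ↦ ?_⟩
    have hu'z : u'.wind z ≠ 0 := (wind_ne_zero_iff_of_udist_le (hη.trans_le (min_le_left _ _)) hdu).2 hu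
    have hv'z : ¬ v'.wind z ≠ 0 := by
      rw [wind_ne_zero_iff_of_udist_le (hη.trans_le (min_le_right _ _)) hdv]
      exact fun h ↦ h hv
    exact hv'z (hsub hu'z)

end Precompact

open Precompact in
/-- **Laminarity passes to `d_CN`-limits of configurations (registered anchor).**  If `x` is, at every scale
`η > 0`, `d_CN ≤ η`-close (`LoopConfig.IsClose η c x`) to a configuration `c` whose loops have pairwise nested
or disjoint winding interiors, then the loops of `x` have pairwise nested or disjoint winding interiors. -/
theorem laminar_of_forall_isClose : ∀ (x : LoopConfig ℂ),
    (∀ η : ℝ, 0 < η → ∃ c : LoopConfig ℂ,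
      (∀ u ∈ c.loops, ∀ v ∈ c.loops,
        {z | u.wind z ≠ 0} ⊆ {z | v.wind z ≠ 0} ∨ {z | v.wind z ≠ 0} ⊆ {z | u.wind z ≠ 0} ∨
          Disjoint {z | u.wind z ≠ 0} {z | v.wind z ≠ 0}) ∧ LoopConfig.IsClose η c x) →
    ∀ u ∈ x.loops, ∀ v ∈ x.loops,
      {z | u.wind z ≠ 0} ⊆ {z | v.wind z ≠ 0} ∨ {z | v.wind z ≠ 0} ⊆ {z | u.wind z ≠ 0} ∨
        Disjoint {z | u.wind z ≠ 0} {z | v.wind z ≠ 0} := by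
  intro x h u hu v hv
  by_contra hcon
  simp only [not_or] at hcon
  obtain ⟨hAB, hBA, hdisj⟩ := hcon
  obtain ⟨z₁, hz₁u, hz₁v⟩ := Set.not_subset.1 hAB
  obtain ⟨z₂, hz₂v, hz₂u⟩ := Set.not_subset.1 hBA
  obtain ⟨z₃, hz₃u, hz₃v⟩ := Set.not_disjoint_iff.1 hdisj
  simp only [mem_setOf_eq, not_not] at hz₁u hz₁v hz₂v hz₂u hz₃u hz₃v
  -- thresholds
  obtain ⟨τ₁, hτ₁, H₁⟩ := exists_threshold_not_subset hz₁u hz₁v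
  obtain ⟨τ₂, hτ₂, H₂⟩ := exists_threshold_not_subset hz₂v hz₂u
  have hρ₃ : 0 < infDist z₃ u.range := infDist_range_pos_of_wind_ne_zero u hz₃u
  have hσ₃ : 0 < infDist z₃ v.range := infDist_range_pos_of_wind_ne_zero v hz₃v
  obtain ⟨Ru, hRu, hsubu⟩ := exists_range_subset_ball u
  obtain ⟨Rv, hRv, hsubv⟩ := exists_range_subset_ball v
  obtain ⟨i, hui⟩ := exists_mem_F_of_mem_loops hu
  obtain ⟨j, hvj⟩ := exists_mem_F_of_mem_loops hv
  set η : ℝ := min (min (min τ₁ τ₂) (min (infDist z₃ u.range) (infDist z₃ v.range)) / 2)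
    (min (1 / Ru) (1 / Rv)) with hηdef
  have hη0 : 0 < η := by positivity
  have hηm : η ≤ min (min τ₁ τ₂) (min (infDist z₃ u.range) (infDist z₃ v.range)) / 2 := min_le_left _ _
  have hm₁ : min (min τ₁ τ₂) (min (infDist z₃ u.range) (infDist z₃ v.range)) ≤ τ₁ :=
    (min_le_left _ _).trans (min_le_left _ _)
  have hm₂ : min (min τ₁ τ₂) (min (infDist z₃ u.range) (infDist z₃ v.range)) ≤ τ₂ :=
    (min_le_left _ _).trans (min_le_right _ _)
  have hm₃ : min (min τ₁ τ₂) (min (infDist z₃ u.range) (infDist z₃ v.range)) ≤ infDist z₃ u.range :=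
    (min_le_right _ _).trans (min_le_left _ _)
  have hm₄ : min (min τ₁ τ₂) (min (infDist z₃ u.range) (infDist z₃ v.range)) ≤ infDist z₃ v.range :=
    (min_le_right _ _).trans (min_le_right _ _)
  have hη₁ : η < τ₁ := by linarith
  have hη₂ : η < τ₂ := by linarith
  have hη₃ : η < infDist z₃ u.range := by linarith
  have hη₄ : η < infDist z₃ v.range := by linarith
  -- partners at scale `η`
  obtain ⟨c, hc, hclose⟩ := h η hη0
  obtain ⟨u', hu', hdu⟩ := (hclose i).2 u hui
    (range_subset_window hRu hη0 ((min_le_right _ _).trans (min_le_left _ _)) hsubu)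
  obtain ⟨v', hv', hdv⟩ := (hclose j).2 v hvj
    (range_subset_window hRv hη0 ((min_le_right _ _).trans (min_le_right _ _)) hsubv)
  -- the partners' interiors meet at `z₃`
  have hu'₃ : u'.wind z₃ ≠ 0 := (wind_ne_zero_iff_of_udist_le hη₃ hdu).2 hz₃u
  have hv'₃ : v'.wind z₃ ≠ 0 := (wind_ne_zero_iff_of_udist_le hη₄ hdv).2 hz₃v
  rcases hc u' (c.subset_loops i hu') v' (c.subset_loops j hv') with hs | hs | hs
  · exact H₁ η u' v' hη₁ hdu hdv hs
  · exact H₂ η v' u' hη₂ hdv hdu hs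
  · exact (Set.disjoint_left.1 hs) hu'₃ hv'₃

namespace Precompact

/-! ### Packaging with the landed lattice regularity -/

/-- **`degreeOne` and `laminar` of `d_CN`-limits of lattice configurations.**  A typed configuration which is,
at every scale `η > 0`, `d_CN ≤ η`-close to SOME positive-mesh sample configuration of one of the two lattice
ensembles `zEns`, `tEns` (all of which are `Regular`: `regular_latticeEnsembles`) has covering degree one and
laminar winding interiors — the two soft fields of `Regular` for limit configurations. -/
theorem degreeOne_laminar_of_forall_isClose_latticeEnsembles {x : LoopConfig ℂ}
    (h : ∀ η : ℝ, 0 < η → ∃ E ∈ latticeEnsembles, ∃ (δ : ℝ) (ω : E.Ω), 0 < δ ∧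
      LoopConfig.IsClose η (E.X δ ω) x) :
    (∀ u ∈ x.loops, ∀ z : ℂ, u.wind z = 0 ∨ u.wind z = 1 ∨ u.wind z = -1) ∧
      ∀ u ∈ x.loops, ∀ v ∈ x.loops,
        {z | u.wind z ≠ 0} ⊆ {z | v.wind z ≠ 0} ∨ {z | v.wind z ≠ 0} ⊆ {z | u.wind z ≠ 0} ∨
          Disjoint {z | u.wind z ≠ 0} {z | v.wind z ≠ 0} := by
  refine ⟨degreeOne_of_forall_isClose fun η hη ↦ ?_, laminar_of_forall_isClose x fun η hη ↦ ?_⟩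
  · obtain ⟨E, hE, δ, ω, hδ, hclose⟩ := h η hη
    exact ⟨E.X δ ω, (regular_latticeEnsembles E hE hδ ω).degreeOne, hclose⟩
  · obtain ⟨E, hE, δ, ω, hδ, hclose⟩ := h η hη
    exact ⟨E.X δ ω, (regular_latticeEnsembles E hE hδ ω).laminar, hclose⟩

/-- Sequential form: a configuration `x` with `d_CN(E.X δₖ ωₖ, x) ≤ εₖ` along a mesh sequence with tolerances
`εₖ → 0` (`εₖ > 0`), for sample configurations `ωₖ` of a lattice ensemble `E ∈ latticeEnsembles` at positive
meshes, has `degreeOne` and `laminar` loops. -/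
theorem degreeOne_laminar_of_isClose_seq {E : LoopEnsemble} (hE : E ∈ latticeEnsembles) {x : LoopConfig ℂ}
    (δs εs : ℕ → ℝ) (ωs : ℕ → E.Ω) (hδ : ∀ k, 0 < δs k) (hε : ∀ k, 0 < εs k)
    (hε0 : Tendsto εs atTop (𝓝 0)) (hclose : ∀ k, LoopConfig.IsClose (εs k) (E.X (δs k) (ωs k)) x) :
    (∀ u ∈ x.loops, ∀ z : ℂ, u.wind z = 0 ∨ u.wind z = 1 ∨ u.wind z = -1) ∧
      ∀ u ∈ x.loops, ∀ v ∈ x.loops,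
        {z | u.wind z ≠ 0} ⊆ {z | v.wind z ≠ 0} ∨ {z | v.wind z ≠ 0} ⊆ {z | u.wind z ≠ 0} ∨
          Disjoint {z | u.wind z ≠ 0} {z | v.wind z ≠ 0} := by
  refine degreeOne_laminar_of_forall_isClose_latticeEnsembles fun η hη ↦ ?_
  obtain ⟨k, hk⟩ := (hε0.eventually (Iio_mem_nhds hη)).exists
  exact ⟨E, hE, δs k, ωs k, hδ k, (hclose k).mono (hε k) (le_of_lt hk)⟩

end Precompact

end Summit.CriticalPhenomena.CardyFormulaZ2.Cruxes.NestingRigidity.PositiveConeWeightDoubling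

end
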